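import Mathlib.MeasureTheory.Measure.Haar.InnerProductSpace
import Mathlib.MeasureTheory.Measure.Lebesgue.VolumeOfBalls
import Mathlib.MeasureTheory.Constructions.Pi
import Mathlib.Analysis.Complex.Exponential
import Literature.Algebra.EuclideanLattices.IntegerBases
import HarnessLib

/-!
# Regev 2004, §3.3: the geometry of shifted balls and of grid points in balls (Claims 3.7–3.8)

Topic `Algebra/EuclideanLattices` (family `pqc`); proved material towards the discharge of the
named fact `Literature.Algebra.EuclideanLattices.usvp_of_dihedralCoset` (O. Regev, *Quantum
computation and lattice problems*, SIAM J. Comput. 33 (2004) 738–760, Thm. 1.1). Everything in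
this file is PROVED; no named fact is introduced.

Regev's improved algorithm (§3.3) measures a lattice point blurred by a uniform grid point of a
ball of radius `R`; the probability that a register is "bad" is governed by two estimates:

* **Claim 3.7** (p. 10): for a ball `B` of radius `R` in `ℝⁿ` and its translate `B + d`,
  `vol(B ∩ (B + d)) / vol(B) ≥ 1 − O(√n ‖d‖ / R)`. Regev's proof: the two caps
  `{⟨x, d⟩ ≥ ‖d‖²/2} ∩ B` and its mirror image lie in `B ∩ (B + d)`, so the loss is at most the
  volume of the slab of width `‖d‖` through the centre, i.e. `‖d‖ · vol(B_{n-1})`, and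
  `vol(B_{n-1})/vol(B_n) = O(√n / R)`.
* **Claim 3.8** (p. 10, special case of Micciancio–Goldwasser 2002, Prop. 8.7): the number of
  points of the grid `ℤⁿ/L` in a convex body containing a large ball is close to `Lⁿ` times its
  volume.

This file proves, in `EuclideanSpace ℝ (Fin n)` with Lebesgue measure (`volume`):

* `volume_ball_inter_slab_le` — **the slab bound** `vol(B_{n+1}(r) ∩ {a ≤ x₀ ≤ b}) ≤
  (b − a) · vol(B_n(r))` (Fubini along the first coordinate, `splitFirst`);
* `volume_ball_le_succ` — **the section ratio** `vol(B_n(r)) ≤ (e^{1/2} √(n+1) / (2r)) ·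
  vol(B_{n+1}(r))` for `n ≥ 1`, by comparing the ball with the inscribed cylinder
  `[−r/√(n+1), r/√(n+1)] × B_n(r √(n/(n+1)))` and `(1 + 1/n)ⁿ ≤ e` (no Gamma-function
  asymptotics are used);
* `volume_ball_diff_ball_le` — **Claim 3.7** in the form `vol(B(0, r) ∖ B(d, r)) ≤
  ‖d‖ · vol(B_n(r))` in `ℝ^{n+1}` (reduction to `d` on the first axis by an orthonormal basis
  through `d/‖d‖`, then the cap/slab argument with the reflection `flipFirst`), whence with the
  section ratio the printed `O(√n ‖d‖/R)` with the explicit constant `e^{1/2}/2`;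
* `card_le_volume_thickening`, `volume_erosion_le_card` — **Claim 3.8 in sandwich form for the
  integer grid**: for any set `A ⊆ ℝⁿ`, the number of integer points in `A` is at most the
  volume of the `√n`-neighbourhood `{x | ∃ a ∈ A, ‖x − a‖ ≤ √n}` and at least the volume of the
  `√n`-erosion `{x | closedBall x √n ⊆ A}` (the unit cells `z + [0,1)ⁿ` of the integer points
  tile `ℝⁿ`, have volume `1`, and have diameter `≤ √n`; Micciancio–Goldwasser's proof of
  Prop. 8.7). The scaled grid `ℤⁿ/L` of the paper is the integer grid after scaling the
  lattice by `L`.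

## References

* O. Regev, *Quantum computation and lattice problems*, SIAM J. Comput. 33 (2004) 738–760,
  §3.3, Claims 3.7, 3.8 and Cor. 3.9 (p. 10).
* D. Micciancio, S. Goldwasser, *Complexity of Lattice Problems: A Cryptographic Perspective*,
  Kluwer 2002, Ch. 8, Prop. 8.7.
-/

noncomputable section

namespace Literature.Algebra.EuclideanLattices

namespace Regev2004

open _root_.MeasureTheory Metric

/-! ### Splitting off the first coordinate; sections and slabs -/

/-- The measurable equivalence `ℝ^{n+1} ≃ ℝ × ℝⁿ` splitting off the first coordinate
(`x ↦ (x₀, (x₁, …, xₙ))`; Fubini along the first axis). [folklore] -/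
def splitFirst (n : ℕ) : EuclideanSpace ℝ (Fin (n + 1)) ≃ᵐ ℝ × (Fin n → ℝ) :=
  (MeasurableEquiv.toLp 2 (Fin (n + 1) → ℝ)).symm.trans (MeasurableEquiv.piFinSuccAbove (fun _ => ℝ) 0)

/-- The first standard unit vector `e₀` of `ℝ^{n+1}`. [folklore] -/
def eFirst (n : ℕ) : EuclideanSpace ℝ (Fin (n + 1)) := EuclideanSpace.single 0 1

/-- The reflection in the hyperplane `x₀ = 0` (negating the first coordinate), as a linear
isometry of `ℝ^{n+1}`. [folklore] -/
def flipFirst (n : ℕ) : EuclideanSpace ℝ (Fin (n + 1)) ≃ₗᵢ[ℝ] EuclideanSpace ℝ (Fin (n + 1)) :=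
  LinearIsometryEquiv.piLpCongrRight 2 fun i : Fin (n + 1) =>
    if i = 0 then LinearIsometryEquiv.neg ℝ else LinearIsometryEquiv.refl ℝ ℝ

/-- The coordinatewise floor `(⌊x_i⌋)_i ∈ ℤⁿ` of a point of `ℝⁿ`. [folklore] -/
def floorPt {n : ℕ} (x : EuclideanSpace ℝ (Fin n)) : Fin n → ℤ := fun i => ⌊x i⌋

/-- The half-open unit cell `z + [0,1)ⁿ = {x | ⌊x⌋ = z}` of an integer vector `z ∈ ℤⁿ` (the unit
cubes around grid points in Micciancio–Goldwasser's proof of Prop. 8.7).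
[cite: MicciancioGoldwasser2002, Ch. 8 Prop. 8.7 (proof)] -/
def zcell {n : ℕ} (z : Fin n → ℤ) : Set (EuclideanSpace ℝ (Fin n)) := {x | floorPt x = z}


/-- `splitFirst x = (x₀, (x₁, …, xₙ))`. [folklore] -/
theorem splitFirst_apply (n : ℕ) (x : EuclideanSpace ℝ (Fin (n + 1))) : splitFirst n x = (x 0, fun j => x j.succ) := by
  simp [splitFirst, MeasurableEquiv.trans_apply, MeasurableEquiv.piFinSuccAbove_apply]
  rfl

/-- `splitFirst` carries Lebesgue measure to the product of Lebesgue measures (Fubini).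
[folklore] -/
theorem measurePreserving_splitFirst (n : ℕ) : MeasurePreserving (splitFirst n) volume volume :=
  (EuclideanSpace.volume_preserving_symm_measurableEquiv_toLp (Fin (n + 1))).trans
    (volume_preserving_piFinSuccAbove (fun _ => ℝ) 0)

/-- First coordinate of `splitFirst⁻¹ (t, y)`. [folklore] -/
theorem splitFirst_symm_apply_zero (n : ℕ) (t : ℝ) (y : Fin n → ℝ) : (splitFirst n).symm (t, y) 0 = t := by
  have h := splitFirst_apply n ((splitFirst n).symm (t, y))
  rw [MeasurableEquiv.apply_symm_apply] at h
  exact (congrArg Prod.fst h).symm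

/-- Later coordinates of `splitFirst⁻¹ (t, y)`. [folklore] -/
theorem splitFirst_symm_apply_succ (n : ℕ) (t : ℝ) (y : Fin n → ℝ) (j : Fin n) :
    (splitFirst n).symm (t, y) j.succ = y j := by
  have h := splitFirst_apply n ((splitFirst n).symm (t, y))
  rw [MeasurableEquiv.apply_symm_apply] at h
  exact (congrFun (congrArg Prod.snd h) j).symm

/-- `‖x‖² = x₀² + ∑_{j ≥ 1} x_j²`. [folklore] -/
theorem norm_sq_eq_succ (n : ℕ) (x : EuclideanSpace ℝ (Fin (n + 1))) : ‖x‖ ^ 2 = (x 0) ^ 2 + ∑ j : Fin n, (x j.succ) ^ 2 := by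
  rw [EuclideanSpace.norm_eq, Real.sq_sqrt (Finset.sum_nonneg fun _ _ => sq_nonneg _), Fin.sum_univ_succ]
  simp [sq_abs]

/-- `‖y‖² = ∑ y_j²`. [folklore] -/
theorem norm_sq_eq_sum (n : ℕ) (y : EuclideanSpace ℝ (Fin n)) : ‖y‖ ^ 2 = ∑ j : Fin n, (y j) ^ 2 := by
  rw [EuclideanSpace.norm_eq, Real.sq_sqrt (Finset.sum_nonneg fun _ _ => sq_nonneg _)]
  simp [sq_abs]

/-- **Fubini along the first coordinate**: the volume of a measurable set is the integral of the
volumes of its sections. [folklore] -/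
theorem volume_eq_lintegral_sections (n : ℕ) {A : Set (EuclideanSpace ℝ (Fin (n + 1)))} (hA : MeasurableSet A) :
    volume A = ∫⁻ t : ℝ, volume {y : Fin n → ℝ | (splitFirst n).symm (t, y) ∈ A} := by
  rw [← (measurePreserving_splitFirst n).symm.measure_preimage hA.nullMeasurableSet,
    show (volume : Measure (ℝ × (Fin n → ℝ))) = volume.prod volume from rfl,
    Measure.prod_apply ((splitFirst n).symm.measurable hA)]
  rfl

/-- Every section of the ball `B_{n+1}(0, r)` lies in (the coordinate image of) the ball
`B_n(0, r)`. [folklore] -/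
theorem section_ball_subset (n : ℕ) (r t : ℝ) :
    {y : Fin n → ℝ | (splitFirst n).symm (t, y) ∈ ball (0 : EuclideanSpace ℝ (Fin (n + 1))) r} ⊆
      (WithLp.toLp 2) ⁻¹' ball (0 : EuclideanSpace ℝ (Fin n)) r := by
  intro y hy
  simp only [Set.mem_setOf_eq, mem_ball_zero_iff, Set.mem_preimage] at hy ⊢
  have h1 := norm_sq_eq_succ n ((splitFirst n).symm (t, y))
  simp only [splitFirst_symm_apply_zero, splitFirst_symm_apply_succ] at h1
  have h2 := norm_sq_eq_sum n (WithLp.toLp 2 y)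
  have hn : 0 ≤ ‖(splitFirst n).symm (t, y)‖ := norm_nonneg _
  nlinarith [norm_nonneg (WithLp.toLp 2 y : EuclideanSpace ℝ (Fin n)), sq_nonneg t]

/-- The coordinate image of a ball has the volume of the ball. [folklore] -/
theorem volume_toLp_preimage_ball (n : ℕ) (r : ℝ) :
    volume ((WithLp.toLp 2) ⁻¹' ball (0 : EuclideanSpace ℝ (Fin n)) r) = volume (ball (0 : EuclideanSpace ℝ (Fin n)) r) :=
  (PiLp.volume_preserving_toLp (Fin n)).measure_preimage measurableSet_ball.nullMeasurableSet

/-- The first coordinate is measurable. [folklore] -/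
theorem measurable_apply_zero (n : ℕ) : Measurable fun x : EuclideanSpace ℝ (Fin (n + 1)) => x 0 := by fun_prop

/-- **The slab bound.** The part of the ball `B_{n+1}(0, r)` between the hyperplanes `x₀ = a` and
`x₀ = b` has volume at most `(b − a) · vol(B_n(0, r))` (each section is a ball of radius
`√(r² − t²) ≤ r`; Regev bounds a cap by "an n-dimensional cylinder of radius R and height
‖d‖/2"). [cite: Regev2004, Claim 3.7 (proof, p. 10)] -/
theorem volume_ball_inter_slab_le (n : ℕ) (r a b : ℝ) :
    volume {x : EuclideanSpace ℝ (Fin (n + 1)) | x ∈ ball (0 : EuclideanSpace ℝ (Fin (n + 1))) r ∧ a ≤ x 0 ∧ x 0 ≤ b} ≤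
      ENNReal.ofReal (b - a) * volume (ball (0 : EuclideanSpace ℝ (Fin n)) r) := by
  have hmeas : MeasurableSet {x : EuclideanSpace ℝ (Fin (n + 1)) | x ∈ ball (0 : EuclideanSpace ℝ (Fin (n + 1))) r ∧ a ≤ x 0 ∧ x 0 ≤ b} := by
    have h0 := measurable_apply_zero n
    exact measurableSet_ball.inter ((h0 measurableSet_Ici).inter (h0 measurableSet_Iic))
  rw [volume_eq_lintegral_sections n hmeas]
  calc ∫⁻ t : ℝ, volume {y : Fin n → ℝ |
          (splitFirst n).symm (t, y) ∈ {x : EuclideanSpace ℝ (Fin (n + 1)) | x ∈ ball 0 r ∧ a ≤ x 0 ∧ x 0 ≤ b}}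
      ≤ ∫⁻ t : ℝ, (Set.Icc a b).indicator (fun _ => volume (ball (0 : EuclideanSpace ℝ (Fin n)) r)) t := by
        refine lintegral_mono fun t => ?_
        by_cases ht : t ∈ Set.Icc a b
        · rw [Set.indicator_of_mem ht, ← volume_toLp_preimage_ball]
          exact measure_mono fun y hy => section_ball_subset n r t hy.1
        · rw [Set.indicator_of_notMem ht]
          refine le_of_eq (measure_eq_zero_iff_ae_notMem.2 (Filter.Eventually.of_forall fun y hy => ht ?_))
          simp only [Set.mem_setOf_eq, splitFirst_symm_apply_zero] at hy
          exact ⟨hy.2.1, hy.2.2⟩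
    _ = ENNReal.ofReal (b - a) * volume (ball (0 : EuclideanSpace ℝ (Fin n)) r) := by
        rw [lintegral_indicator_const measurableSet_Icc, Real.volume_Icc, mul_comm]

/-! ### The section ratio `vol(B_n) / vol(B_{n+1}) = O(√n / r)` by an inscribed cylinder -/

/-- **Cylinder bound**: the cylinder `[−a, a] × B_n(0, ρ)` with `a² + ρ² ≤ r²` lies in
`B_{n+1}(0, r)`, so `2a · vol(B_n(ρ)) ≤ vol(B_{n+1}(r))`. [folklore] -/
theorem cylinder_volume_le (n : ℕ) {r a ρ : ℝ} (hr : 0 ≤ r) (h : a ^ 2 + ρ ^ 2 ≤ r ^ 2) :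
    ENNReal.ofReal (2 * a) * volume (ball (0 : EuclideanSpace ℝ (Fin n)) ρ) ≤ volume (ball (0 : EuclideanSpace ℝ (Fin (n + 1))) r) := by
  set C : Set (ℝ × (Fin n → ℝ)) := Set.Icc (-a) a ×ˢ ((WithLp.toLp 2) ⁻¹' ball (0 : EuclideanSpace ℝ (Fin n)) ρ) with hC
  have hCvol : volume C = ENNReal.ofReal (2 * a) * volume (ball (0 : EuclideanSpace ℝ (Fin n)) ρ) := by
    rw [hC, show (volume : Measure (ℝ × (Fin n → ℝ))) = volume.prod volume from rfl,
      Measure.prod_prod, Real.volume_Icc, volume_toLp_preimage_ball, show a - -a = 2 * a by ring]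
  have hsub : (splitFirst n).symm '' C ⊆ ball (0 : EuclideanSpace ℝ (Fin (n + 1))) r := by
    rintro _ ⟨⟨t, y⟩, ⟨ht, hy⟩, rfl⟩
    rw [mem_ball_zero_iff]
    simp only [Set.mem_preimage, mem_ball_zero_iff] at hy
    simp only [Set.mem_Icc] at ht
    have h1 := norm_sq_eq_succ n ((splitFirst n).symm (t, y))
    simp only [splitFirst_symm_apply_zero, splitFirst_symm_apply_succ] at h1
    have h2 := norm_sq_eq_sum n (WithLp.toLp 2 y)
    have ht2 : t ^ 2 ≤ a ^ 2 := by nlinarith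
    have hy2 : ‖(WithLp.toLp 2 y : EuclideanSpace ℝ (Fin n))‖ ^ 2 < ρ ^ 2 := by
      have := norm_nonneg (WithLp.toLp 2 y : EuclideanSpace ℝ (Fin n))
      nlinarith
    have hlt : ‖(splitFirst n).symm (t, y)‖ ^ 2 < r ^ 2 := by
      rw [h1]
      have : ∑ j : Fin n, y j ^ 2 = ‖(WithLp.toLp 2 y : EuclideanSpace ℝ (Fin n))‖ ^ 2 := by rw [h2]
      rw [this]; linarith
    exact lt_of_pow_lt_pow_left₀ 2 hr hlt
  calc ENNReal.ofReal (2 * a) * volume (ball (0 : EuclideanSpace ℝ (Fin n)) ρ) = volume C := hCvol.symm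
    _ = volume ((splitFirst n).symm '' C) := by
        rw [MeasurableEquiv.image_symm,
          (measurePreserving_splitFirst n).measure_preimage_emb (splitFirst n).measurableEmbedding]
    _ ≤ volume (ball (0 : EuclideanSpace ℝ (Fin (n + 1))) r) := measure_mono hsub

/-- `e⁻¹ ≤ (n/(n+1))ⁿ` for `n ≥ 1` (from `1 + x ≤ eˣ`). [folklore] -/
theorem exp_neg_one_le_pow (n : ℕ) (hn : 0 < n) : Real.exp (-1) ≤ ((n : ℝ) / (n + 1)) ^ n := by
  have hn' : (0 : ℝ) < n := by exact_mod_cast hn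
  have h1 : (1 : ℝ) + 1 / n ≤ Real.exp (1 / n) := by
    have := Real.add_one_le_exp (1 / (n : ℝ)); linarith
  have h2 : ((1 : ℝ) + 1 / n) ^ n ≤ Real.exp 1 := by
    calc ((1 : ℝ) + 1 / n) ^ n ≤ (Real.exp (1 / n)) ^ n := pow_le_pow_left₀ (by positivity) h1 n
      _ = Real.exp 1 := by rw [← Real.exp_nat_mul]; congr 1; field_simp
  have h3 : ((n : ℝ) / (n + 1)) ^ n = (((1 : ℝ) + 1 / n) ^ n)⁻¹ := by
    rw [← inv_pow]; congr 1; field_simp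
  rw [h3, Real.exp_neg]
  exact inv_anti₀ (by positivity) h2

/-- Balls of positive radius have the volume of the unit ball times `rⁿ`. [folklore] -/
theorem volume_ball_eq_pow_mul (n : ℕ) {r : ℝ} (hr : 0 < r) :
    volume (ball (0 : EuclideanSpace ℝ (Fin n)) r) = ENNReal.ofReal (r ^ n) * volume (ball (0 : EuclideanSpace ℝ (Fin n)) 1) := by
  rw [Measure.addHaar_ball_of_pos _ _ hr, finrank_euclideanSpace, Fintype.card_fin]

/-- Scaling between two radii: `vol(B(q r)) = qⁿ vol(B(r))` for `q > 0`. [folklore] -/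
theorem volume_ball_mul_eq (n : ℕ) {q : ℝ} (hq : 0 < q) (r : ℝ) :
    volume (ball (0 : EuclideanSpace ℝ (Fin n)) (q * r)) = ENNReal.ofReal (q ^ n) * volume (ball (0 : EuclideanSpace ℝ (Fin n)) r) := by
  rw [Measure.addHaar_ball_mul_of_pos _ _ hq, finrank_euclideanSpace, Fintype.card_fin]

/-- **The section ratio** (Regev: "`vol(B_{n−1})/vol(B_n) = O(√n/R)`", with an explicit
constant): `vol(B_n(r)) ≤ (e^{1/2} √(n+1) / (2r)) · vol(B_{n+1}(r))` for `n ≥ 1`, `r > 0`.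
Proof: the inscribed cylinder of half-height `r/√(n+1)` and radius `r √(n/(n+1))`
(`cylinder_volume_le`), scaling, and `(n/(n+1))^{n/2} ≥ e^{-1/2}`.
[cite: Regev2004, Claim 3.7 (proof, last line, p. 10)] -/
theorem volume_ball_le_succ (n : ℕ) (hn : 0 < n) {r : ℝ} (hr : 0 < r) :
    volume (ball (0 : EuclideanSpace ℝ (Fin n)) r) ≤
      ENNReal.ofReal (Real.exp (1 / 2) * Real.sqrt (n + 1) / (2 * r)) * volume (ball (0 : EuclideanSpace ℝ (Fin (n + 1))) r) := by
  have hn1 : (0 : ℝ) < n + 1 := by positivity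
  set q : ℝ := Real.sqrt ((n : ℝ) / (n + 1)) with hq
  have hq0 : 0 < q := Real.sqrt_pos.2 (by positivity)
  have hq2 : q ^ 2 = (n : ℝ) / (n + 1) := Real.sq_sqrt (by positivity)
  set a : ℝ := r / Real.sqrt (n + 1) with ha
  have hs1 : Real.sqrt ((n : ℝ) + 1) ^ 2 = n + 1 := Real.sq_sqrt hn1.le
  have hs0 : 0 < Real.sqrt ((n : ℝ) + 1) := Real.sqrt_pos.2 hn1
  have hsum : a ^ 2 + (q * r) ^ 2 ≤ r ^ 2 := by
    have e1 : a ^ 2 = r ^ 2 / (n + 1) := by rw [ha, div_pow, hs1]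
    rw [e1, mul_pow, hq2]
    have e2 : r ^ 2 / (n + 1) + (n : ℝ) / (n + 1) * r ^ 2 = r ^ 2 := by field_simp; ring
    rw [e2]
  have hcyl := cylinder_volume_le n hr.le hsum
  rw [volume_ball_mul_eq n hq0, ← mul_assoc, ← ENNReal.ofReal_mul (by positivity)] at hcyl
  have hqn : Real.exp (-1) ≤ (q ^ n) ^ 2 := by
    rw [← pow_mul, mul_comm, pow_mul, hq2]; exact exp_neg_one_le_pow n hn
  have hqn' : Real.exp (-(1 / 2)) ≤ q ^ n := by
    have h1 : Real.exp (-(1 / 2)) ^ 2 = Real.exp (-1) := by rw [← Real.exp_nat_mul]; norm_num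
    exact (pow_le_pow_iff_left₀ (Real.exp_pos _).le (pow_nonneg hq0.le n) two_ne_zero).1 (h1 ▸ hqn)
  have hc0 : 0 < 2 * a * q ^ n := by positivity
  have hK : (2 * a * q ^ n)⁻¹ ≤ Real.exp (1 / 2) * Real.sqrt (n + 1) / (2 * r) := by
    rw [inv_le_comm₀ hc0 (by positivity)]
    calc (Real.exp (1 / 2) * Real.sqrt (n + 1) / (2 * r))⁻¹ = 2 * a * Real.exp (-(1 / 2)) := by
          rw [Real.exp_neg, ha]; field_simp
      _ ≤ 2 * a * q ^ n := mul_le_mul_of_nonneg_left hqn' (by positivity)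
  calc volume (ball (0 : EuclideanSpace ℝ (Fin n)) r)
      = (ENNReal.ofReal (2 * a * q ^ n))⁻¹ * (ENNReal.ofReal (2 * a * q ^ n) * volume (ball (0 : EuclideanSpace ℝ (Fin n)) r)) := by
        rw [← mul_assoc, ENNReal.inv_mul_cancel (by simpa using hc0) ENNReal.ofReal_ne_top, one_mul]
    _ ≤ (ENNReal.ofReal (2 * a * q ^ n))⁻¹ * volume (ball (0 : EuclideanSpace ℝ (Fin (n + 1))) r) := by gcongr
    _ ≤ ENNReal.ofReal (Real.exp (1 / 2) * Real.sqrt (n + 1) / (2 * r)) * volume (ball (0 : EuclideanSpace ℝ (Fin (n + 1))) r) := by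
        rw [← ENNReal.ofReal_inv_of_pos hc0]
        gcongr

/-! ### Claim 3.7: a ball and its translate overlap up to a slab -/

/-- `eFirst` has first coordinate `1`. [folklore] -/
@[simp] theorem eFirst_zero (n : ℕ) : eFirst n 0 = 1 := by simp [eFirst]

/-- `eFirst` has all later coordinates `0`. [folklore] -/
@[simp] theorem eFirst_succ (n : ℕ) (j : Fin n) : eFirst n j.succ = 0 := by simp [eFirst, Fin.succ_ne_zero]

/-- `‖x − σ e₀‖² = ‖x‖² − 2σ x₀ + σ²`. [folklore] -/
theorem norm_sq_sub_smul_eFirst (n : ℕ) (x : EuclideanSpace ℝ (Fin (n + 1))) (σ : ℝ) :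
    ‖x - σ • eFirst n‖ ^ 2 = ‖x‖ ^ 2 - 2 * σ * x 0 + σ ^ 2 := by
  rw [norm_sq_eq_succ, norm_sq_eq_succ]
  simp only [PiLp.sub_apply, PiLp.smul_apply, eFirst_zero, eFirst_succ, smul_eq_mul, mul_one, mul_zero, sub_zero]
  ring

/-- `flipFirst` negates the first coordinate. [folklore] -/
@[simp] theorem flipFirst_apply_zero (n : ℕ) (x : EuclideanSpace ℝ (Fin (n + 1))) : flipFirst n x 0 = -x 0 := by
  simp [flipFirst, LinearIsometryEquiv.piLpCongrRight_apply]

/-- `flipFirst` fixes the later coordinates. [folklore] -/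
@[simp] theorem flipFirst_apply_succ (n : ℕ) (x : EuclideanSpace ℝ (Fin (n + 1))) (j : Fin n) : flipFirst n x j.succ = x j.succ := by
  simp [flipFirst, LinearIsometryEquiv.piLpCongrRight_apply, Fin.succ_ne_zero]

/-- **Claim 3.7, shift along the first axis.** For `σ ≥ 0`,
`vol(B(0, r) ∖ B(σ e₀, r)) ≤ σ · vol(B_n(r))`: the ball splits into the caps `x₀ > σ/2`,
`x₀ < −σ/2` and the closed slab between them; the first cap lies in `B ∩ (B + σe₀)`, so does the
translate by `σ e₀` of the second (which has the volume of the first, by the reflection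
`flipFirst` and translation invariance), and the two are disjoint; hence
`vol(B) ≤ vol(slab) + vol(B ∩ (B + σe₀))`, and the slab bound applies.
[cite: Regev2004, Claim 3.7 (p. 10)] -/
theorem volume_ball_diff_shift_axis_le (n : ℕ) (r : ℝ) {σ : ℝ} (hσ : 0 ≤ σ) :
    volume (ball (0 : EuclideanSpace ℝ (Fin (n + 1))) r \ ((fun x => x - σ • eFirst n) ⁻¹' ball (0 : EuclideanSpace ℝ (Fin (n + 1))) r)) ≤
      ENNReal.ofReal σ * volume (ball (0 : EuclideanSpace ℝ (Fin n)) r) := by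
  set B : Set (EuclideanSpace ℝ (Fin (n + 1))) := ball 0 r with hB
  set B' : Set (EuclideanSpace ℝ (Fin (n + 1))) := (fun x => x - σ • eFirst n) ⁻¹' ball (0 : EuclideanSpace ℝ (Fin (n + 1))) r with hB'
  set P : Set (EuclideanSpace ℝ (Fin (n + 1))) := {x | x ∈ B ∧ σ / 2 < x 0} with hP
  set M : Set (EuclideanSpace ℝ (Fin (n + 1))) := {x | x ∈ B ∧ x 0 < -(σ / 2)} with hM
  set Sl : Set (EuclideanSpace ℝ (Fin (n + 1))) := {x | x ∈ B ∧ -(σ / 2) ≤ x 0 ∧ x 0 ≤ σ / 2} with hSl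
  set M' : Set (EuclideanSpace ℝ (Fin (n + 1))) := {x | x ∈ B' ∧ x 0 < σ / 2} with hM'
  have hmB : MeasurableSet B := measurableSet_ball
  have hcont : Continuous fun x : EuclideanSpace ℝ (Fin (n + 1)) => x - σ • eFirst n := by fun_prop
  have hmB' : MeasurableSet B' := hcont.measurable measurableSet_ball
  have h0 := measurable_apply_zero n
  have hmP : MeasurableSet P := hmB.inter (h0 measurableSet_Ioi)
  have hmM : MeasurableSet M := hmB.inter (h0 measurableSet_Iio)
  have hmSl : MeasurableSet Sl := hmB.inter ((h0 measurableSet_Ici).inter (h0 measurableSet_Iic))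
  have hmM' : MeasurableSet M' := hmB'.inter (h0 measurableSet_Iio)
  have memB : ∀ x : EuclideanSpace ℝ (Fin (n + 1)), x ∈ B ↔ ‖x‖ < r := fun x => mem_ball_zero_iff
  have memB' : ∀ x : EuclideanSpace ℝ (Fin (n + 1)), x ∈ B' ↔ ‖x - σ • eFirst n‖ < r := fun x => by simp [hB']
  -- (a) the partition of `B`
  have hBeq : B = (P ∪ M) ∪ Sl := by
    ext x
    simp only [hP, hM, hSl, Set.mem_union, Set.mem_setOf_eq]
    constructor
    · intro hx
      by_cases h1 : σ / 2 < x 0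
      · exact Or.inl (Or.inl ⟨hx, h1⟩)
      by_cases h2 : x 0 < -(σ / 2)
      · exact Or.inl (Or.inr ⟨hx, h2⟩)
      · exact Or.inr ⟨hx, not_lt.1 h2, not_lt.1 h1⟩
    · rintro ((⟨hx, -⟩ | ⟨hx, -⟩) | ⟨hx, -⟩) <;> exact hx
  have hdPM : Disjoint P M := by
    rw [Set.disjoint_left]
    rintro x ⟨-, h1⟩ ⟨-, h2⟩
    linarith
  have hdPMS : Disjoint (P ∪ M) Sl := by
    rw [Set.disjoint_left]
    rintro x (⟨-, h1⟩ | ⟨-, h1⟩) ⟨-, h2, h3⟩ <;> linarith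
  have hvolB : volume B = volume P + volume M + volume Sl := by
    rw [hBeq, measure_union hdPMS hmSl, measure_union hdPM hmM]
  -- (b), (c): the cap `P` and the shifted cap `M'` lie in `B ∩ B'`, disjointly
  have hPsub : P ⊆ B ∩ B' := by
    rintro x ⟨hx, h1⟩
    refine ⟨hx, ?_⟩
    rw [memB] at hx
    rw [memB']
    have hx0 : 0 ≤ ‖x‖ := norm_nonneg _
    have hsq : ‖x - σ • eFirst n‖ ^ 2 < r ^ 2 := by rw [norm_sq_sub_smul_eFirst]; nlinarith
    exact lt_of_pow_lt_pow_left₀ 2 (by nlinarith) hsq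
  have hM'sub : M' ⊆ B ∩ B' := by
    rintro x ⟨hx, h1⟩
    refine ⟨?_, hx⟩
    rw [memB'] at hx
    rw [memB]
    have hx0 : 0 ≤ ‖x - σ • eFirst n‖ := norm_nonneg _
    have hsq : ‖x‖ ^ 2 < r ^ 2 := by have := norm_sq_sub_smul_eFirst n x σ; nlinarith
    exact lt_of_pow_lt_pow_left₀ 2 (by nlinarith) hsq
  have hdPM' : Disjoint P M' := by
    rw [Set.disjoint_left]
    rintro x ⟨-, h1⟩ ⟨-, h2⟩
    linarith
  -- (d) `vol M' = vol M` (translation invariance)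
  have hM'eq : M' = (fun x => -(σ • eFirst n) + x) ⁻¹' M := by
    ext x
    simp only [hM', hM, hB', Set.mem_setOf_eq, Set.mem_preimage, neg_add_eq_sub]
    constructor
    · rintro ⟨hx, h1⟩
      exact ⟨hx, by rw [PiLp.sub_apply, PiLp.smul_apply, eFirst_zero]; simp; linarith⟩
    · rintro ⟨hx, h1⟩
      refine ⟨hx, ?_⟩
      rw [PiLp.sub_apply, PiLp.smul_apply, eFirst_zero] at h1
      simp at h1
      linarith
  have hvolM' : volume M' = volume M := by rw [hM'eq, measure_preimage_add]
  -- (e) `vol M = vol P` (reflection)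
  have hMeq : M = flipFirst n ⁻¹' P := by
    ext x
    simp only [hM, hP, Set.mem_setOf_eq, Set.mem_preimage, memB, LinearIsometryEquiv.norm_map, flipFirst_apply_zero]
    constructor <;> rintro ⟨hx, h1⟩ <;> exact ⟨hx, by linarith⟩
  have hvolM : volume M = volume P := by
    rw [hMeq]; exact (flipFirst n).measurePreserving.measure_preimage hmP.nullMeasurableSet
  -- (f) `vol B ≤ vol Sl + vol (B ∩ B')`
  have hf : volume B ≤ volume Sl + volume (B ∩ B') := by
    have hPM' : volume P + volume M' ≤ volume (B ∩ B') := by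
      rw [← measure_union hdPM' hmM']
      exact measure_mono (Set.union_subset hPsub hM'sub)
    rw [hvolB, ← hvolM', add_comm]
    gcongr
  -- (g) conclusion
  have hfin : volume (B ∩ B') ≠ ⊤ := (measure_mono Set.inter_subset_left).trans_lt measure_ball_lt_top |>.ne
  calc volume (B \ B') = volume (B \ (B ∩ B')) := by rw [Set.sdiff_self_inter]
    _ = volume B - volume (B ∩ B') := measure_sdiff Set.inter_subset_left (hmB.inter hmB').nullMeasurableSet hfin
    _ ≤ volume Sl := tsub_le_iff_right.2 hf
    _ ≤ ENNReal.ofReal (σ / 2 - -(σ / 2)) * volume (ball (0 : EuclideanSpace ℝ (Fin n)) r) := volume_ball_inter_slab_le n r _ _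
    _ = ENNReal.ofReal σ * volume (ball (0 : EuclideanSpace ℝ (Fin n)) r) := by congr 2; ring

/-- **Regev 2004, Claim 3.7** (general shift `d`): in `ℝ^{n+1}`,
`vol(B(0, r) ∖ B(d, r)) ≤ ‖d‖ · vol(B_n(r))`, i.e. with `vol(B ∩ (B + d)) = vol(B) − vol(B ∖ (B+d))`
and the section ratio, `vol(B ∩ (B + d))/vol(B) ≥ 1 − (e^{1/2}/2) √(n+1) ‖d‖ / r`. Reduction to
the axis case by an orthonormal basis whose first vector is `d/‖d‖` (its coordinate map is a
measure-preserving linear isometry). [cite: Regev2004, Claim 3.7 (p. 10)] -/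
theorem volume_ball_diff_ball_le (n : ℕ) (r : ℝ) (d : EuclideanSpace ℝ (Fin (n + 1))) :
    volume (ball (0 : EuclideanSpace ℝ (Fin (n + 1))) r \ ball d r) ≤ ENNReal.ofReal ‖d‖ * volume (ball (0 : EuclideanSpace ℝ (Fin n)) r) := by
  by_cases hd : d = 0
  · subst hd; simp
  set v : EuclideanSpace ℝ (Fin (n + 1)) := ‖d‖⁻¹ • d with hv
  have hdn : 0 < ‖d‖ := norm_pos_iff.2 hd
  have hv1 : ‖v‖ = 1 := by rw [hv, norm_smul, norm_inv, norm_norm, inv_mul_cancel₀ hdn.ne']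
  have hon : Orthonormal ℝ (({0} : Set (Fin (n + 1))).restrict fun _ : Fin (n + 1) => v) := by
    rw [orthonormal_subsingleton_iff]
    intro i; exact hv1
  obtain ⟨b, hb⟩ := hon.exists_orthonormalBasis_extension_of_card_eq (by simp [finrank_euclideanSpace])
  have hb0 : b 0 = v := hb 0 rfl
  set f := b.repr with hf
  have hfd : f d = ‖d‖ • eFirst n := by
    have e1 : d = ‖d‖ • b 0 := by rw [hb0, hv, smul_smul, mul_inv_cancel₀ hdn.ne', one_smul]
    conv_lhs => rw [e1, map_smul, hf, OrthonormalBasis.repr_self]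
    rfl
  have hset : ball (0 : EuclideanSpace ℝ (Fin (n + 1))) r \ ball d r =
      f ⁻¹' (ball (0 : EuclideanSpace ℝ (Fin (n + 1))) r \ ((fun x => x - ‖d‖ • eFirst n) ⁻¹' ball (0 : EuclideanSpace ℝ (Fin (n + 1))) r)) := by
    ext x
    simp only [Set.mem_sdiff, Set.mem_preimage, mem_ball, dist_eq_norm, ← hfd, ← map_sub, sub_zero,
      LinearIsometryEquiv.norm_map]
  have hmeas : MeasurableSet
      (ball (0 : EuclideanSpace ℝ (Fin (n + 1))) r \ ((fun x => x - ‖d‖ • eFirst n) ⁻¹' ball (0 : EuclideanSpace ℝ (Fin (n + 1))) r)) :=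
    measurableSet_ball.diff
      ((by fun_prop : Continuous fun x : EuclideanSpace ℝ (Fin (n + 1)) => x - ‖d‖ • eFirst n).measurable measurableSet_ball)
  rw [hset, f.measurePreserving.measure_preimage hmeas.nullMeasurableSet]
  exact volume_ball_diff_shift_axis_le n r (norm_nonneg d)

/-- Claim 3.7 with the section ratio inserted: for `n ≥ 1` and `r > 0`, in `ℝ^{n+1}`,
`vol(B(0, r) ∖ B(d, r)) ≤ (e^{1/2} √(n+1) ‖d‖ / (2r)) · vol(B(0, r))`.
[cite: Regev2004, Claim 3.7 (p. 10)] -/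
theorem volume_ball_diff_ball_le_mul_self (n : ℕ) (hn : 0 < n) {r : ℝ} (hr : 0 < r) (d : EuclideanSpace ℝ (Fin (n + 1))) :
    volume (ball (0 : EuclideanSpace ℝ (Fin (n + 1))) r \ ball d r) ≤
      ENNReal.ofReal (Real.exp (1 / 2) * Real.sqrt (n + 1) * ‖d‖ / (2 * r)) * volume (ball (0 : EuclideanSpace ℝ (Fin (n + 1))) r) := by
  calc volume (ball (0 : EuclideanSpace ℝ (Fin (n + 1))) r \ ball d r) ≤ ENNReal.ofReal ‖d‖ * volume (ball (0 : EuclideanSpace ℝ (Fin n)) r) :=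
        volume_ball_diff_ball_le n r d
    _ ≤ ENNReal.ofReal ‖d‖ * (ENNReal.ofReal (Real.exp (1 / 2) * Real.sqrt (n + 1) / (2 * r)) *
          volume (ball (0 : EuclideanSpace ℝ (Fin (n + 1))) r)) := by gcongr; exact volume_ball_le_succ n hn hr
    _ = ENNReal.ofReal (Real.exp (1 / 2) * Real.sqrt (n + 1) * ‖d‖ / (2 * r)) * volume (ball (0 : EuclideanSpace ℝ (Fin (n + 1))) r) := by
        rw [← mul_assoc, ← ENNReal.ofReal_mul (norm_nonneg d)]
        congr 2
        ring

/-! ### Claim 3.8: integer points versus volume (the unit cells of `ℤⁿ` tile `ℝⁿ`) -/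

variable {n : ℕ}

/-- Membership in a cell, coordinatewise. [folklore] -/
theorem mem_zcell_iff (z : Fin n → ℤ) (x : EuclideanSpace ℝ (Fin n)) : x ∈ zcell z ↔ ∀ i, ⌊x i⌋ = z i := by
  simp [zcell, floorPt, funext_iff]

/-- Every point lies in the cell of its floor. [folklore] -/
theorem mem_zcell_floorPt (x : EuclideanSpace ℝ (Fin n)) : x ∈ zcell (floorPt x) := rfl

/-- A cell is the coordinate image of a product of unit intervals. [folklore] -/
theorem zcell_eq_preimage (z : Fin n → ℤ) :
    zcell z = (WithLp.ofLp : EuclideanSpace ℝ (Fin n) → (Fin n → ℝ)) ⁻¹' Set.pi Set.univ fun i => Set.Ico (z i : ℝ) (z i + 1) := by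
  ext x
  simp only [mem_zcell_iff, Set.mem_preimage, Set.mem_pi, Set.mem_univ, forall_const, Set.mem_Ico, Int.floor_eq_iff]

/-- Cells are measurable. [folklore] -/
theorem measurableSet_zcell (z : Fin n → ℤ) : MeasurableSet (zcell z) := by
  rw [zcell_eq_preimage]
  exact (PiLp.continuous_ofLp 2 _).measurable (MeasurableSet.univ_pi fun _ => measurableSet_Ico)

/-- **Cells have volume `1`.** [folklore] -/
theorem volume_zcell (z : Fin n → ℤ) : volume (zcell z) = 1 := by
  rw [zcell_eq_preimage, (PiLp.volume_preserving_ofLp (Fin n)).measure_preimage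
    (MeasurableSet.univ_pi fun _ => measurableSet_Ico).nullMeasurableSet, volume_pi_pi]
  simp

/-- **Distinct cells are disjoint.** [folklore] -/
theorem disjoint_zcell {z z' : Fin n → ℤ} (h : z ≠ z') : Disjoint (zcell z) (zcell z') := by
  rw [Set.disjoint_left]
  intro x hx hx'
  exact h (hx.symm.trans hx')

/-- **Cells have radius at most `√n`**: a point is within `√n` of the integer point of its cell.
[folklore] -/
theorem norm_sub_intVec_floorPt_le (x : EuclideanSpace ℝ (Fin n)) : ‖x - intVecToEuclidean n (floorPt x)‖ ≤ Real.sqrt n := by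
  rw [EuclideanSpace.norm_eq]
  apply Real.sqrt_le_sqrt
  calc ∑ i, ‖(x - intVecToEuclidean n (floorPt x)) i‖ ^ 2 ≤ ∑ _i : Fin n, (1 : ℝ) := by
        refine Finset.sum_le_sum fun i _ => ?_
        simp only [PiLp.sub_apply, intVecToEuclidean_apply, floorPt, Real.norm_eq_abs, sq_abs]
        have h1 := Int.floor_le (x i)
        have h2 := Int.lt_floor_add_one (x i)
        nlinarith
    _ = n := by simp

/-- The union of the cells of finitely many integer vectors has volume their number. [folklore] -/
theorem volume_biUnion_zcell (T : Finset (Fin n → ℤ)) : volume (⋃ z ∈ T, zcell z) = T.card := by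
  rw [measure_biUnion_finset (fun z _ z' _ h => disjoint_zcell h) (fun z _ => measurableSet_zcell z)]
  simp [volume_zcell]

/-- **Claim 3.8, upper half.** Finitely many integer points of a set `A ⊆ ℝⁿ` are at most as
numerous as the volume of the `√n`-neighbourhood `{x | ∃ a ∈ A, ‖x − a‖ ≤ √n}` of `A` (their
cells are disjoint, of volume `1`, and lie in that neighbourhood).
[cite: MicciancioGoldwasser2002, Ch. 8 Prop. 8.7] -/
theorem card_le_volume_thickening (A : Set (EuclideanSpace ℝ (Fin n))) (T : Finset (Fin n → ℤ)) (hT : ∀ z ∈ T, intVecToEuclidean n z ∈ A) :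
    (T.card : ENNReal) ≤ volume {x : EuclideanSpace ℝ (Fin n) | ∃ a ∈ A, ‖x - a‖ ≤ Real.sqrt n} := by
  rw [← volume_biUnion_zcell T]
  refine measure_mono fun x hx => ?_
  simp only [Set.mem_iUnion, exists_prop] at hx
  obtain ⟨z, hz, hxz⟩ := hx
  refine ⟨intVecToEuclidean n z, hT z hz, ?_⟩
  have e : floorPt x = z := hxz
  rw [← e]
  exact norm_sub_intVec_floorPt_le x

/-- **Claim 3.8, lower half.** A finite set of integer vectors containing every integer point of
`A ⊆ ℝⁿ` is at least as numerous as the volume of the `√n`-erosion `{x | closedBall x √n ⊆ A}` of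
`A` (the floor of such a point is an integer point of `A`, and the point lies in its cell).
[cite: MicciancioGoldwasser2002, Ch. 8 Prop. 8.7] -/
theorem volume_erosion_le_card (A : Set (EuclideanSpace ℝ (Fin n))) (T : Finset (Fin n → ℤ)) (hT : ∀ z, intVecToEuclidean n z ∈ A → z ∈ T) :
    volume {x : EuclideanSpace ℝ (Fin n) | closedBall x (Real.sqrt n) ⊆ A} ≤ (T.card : ENNReal) := by
  rw [← volume_biUnion_zcell T]
  refine measure_mono fun x hx => ?_
  simp only [Set.mem_iUnion, exists_prop]
  refine ⟨floorPt x, hT _ (hx ?_), mem_zcell_floorPt x⟩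
  rw [mem_closedBall, dist_comm, dist_eq_norm]
  exact norm_sub_intVec_floorPt_le x

/-- The two halves together, for the finite set of ALL integer points of a bounded set `A`
(given as a `Finset` `T` with `z ∈ T ↔ intVecToEuclidean n z ∈ A`):
`vol({x | closedBall x √n ⊆ A}) ≤ #T ≤ vol({x | ∃ a ∈ A, ‖x − a‖ ≤ √n})`.
[cite: Regev2004, Claim 3.8 (p. 10)] -/
theorem volume_erosion_le_card_and_card_le (A : Set (EuclideanSpace ℝ (Fin n))) (T : Finset (Fin n → ℤ))
    (hT : ∀ z, z ∈ T ↔ intVecToEuclidean n z ∈ A) :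
    volume {x : EuclideanSpace ℝ (Fin n) | closedBall x (Real.sqrt n) ⊆ A} ≤ (T.card : ENNReal) ∧
      (T.card : ENNReal) ≤ volume {x : EuclideanSpace ℝ (Fin n) | ∃ a ∈ A, ‖x - a‖ ≤ Real.sqrt n} :=
  ⟨volume_erosion_le_card A T fun z hz => (hT z).2 hz, card_le_volume_thickening A T fun z hz => (hT z).1 hz⟩

end Regev2004

end Literature.Algebra.EuclideanLattices

end
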